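import Literature.Computability.AlgebraicComplexity.Valiant3CNFMatrix
import Literature.Computability.Complexity.SharpSATMembership
import Literature.Computability.Complexity.IndexAllBricks
import Literature.Computability.Complexity.FoldBricks
import Literature.Computability.Complexity.PlumbingBricks
import Literature.Computability.Complexity.HashBricks
import HarnessLib

/-!
# Valiant's reduction `#3SAT → 0/1-permanent` as a polynomial-time machine, I: literal access and the occurrence predicates

First machine file of the discharge of Valiant's theorem (Valiant 1979, Thm. 1) in the tree's
Turing-machine model: the mathematics (`CNFPermanent`, `ValiantAllAtOnce`, `Valiant3CNFMatrix`,
`Valiant3CNFFlat`) ends with a closed-form `0/1` matrix `valiant01 ψ` of a 3-CNF `ψ` whose permanent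
determines `numSat ψ`; a reduction MACHINE has to write that matrix down in time polynomial in the
code of `ψ`. As everywhere in the tree, no machine is programmed directly: the map is assembled from
the `FP` bricks of `Complexity/` (records `boolPair`, `fanoutFn`, `iteFn`, counted loops,
`HashBricks.nthItemFn`, `Brick.allIdxFn`, `Plumb.divModFn`, …), all arithmetic on indices being
UNARY (`ones k`). This file provides the pieces that read the formula:

* `ValiantFP.litF ⟨⌜ψ⌝, 1ᵒ⟩` — the code `⟨bin v, [b]⟩` of the literal of occurrence `o = 3j + i`
  (clause `j`, position `i`; two `nthItemFn` look-ups, `litF_encode`); `varF`, `polF` (the variable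
  numeral and the polarity bit);
* `ValiantFP.varEqF ⟨⌜ψ⌝, ⟨1ᵒ, 1ᵒ'⟩⟩ = [var o = var o']` (`varEqF_encode`);
* the index predicates of `Valiant3CNFMatrix.lean` as one-bit bricks: `isFirstF`, `isLastF`,
  `isNextF` with `isFirstF_encode : isFirstF ⟨⌜ψ⌝, 1ᵒ⟩ = [isFirst3 ψ o]` etc. (index-all loops
  `Brick.allIdxFn` over the earlier / later occurrences);
each with its `∈ FP` and `OneBit` facts. `⌜ψ⌝ = encodingCNF.encode ψ` throughout (the canonical
code; the machine of the sequel canonicalises its input first, `KSATRed.canonCNFFn`).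

## References

* L. G. Valiant, *The complexity of computing the permanent*, Theoret. Comput. Sci. 8 (1979)
  189–201, Thm. 1, Lemma 3.1 ("there is a function `f ∈ FP` …").
* S. Arora, B. Barak, *Computational Complexity: A Modern Approach*, CUP 2009, §1.3 (polynomial
  time is closed under composition and bounded loops), §0.1 (codes of lists).
-/

noncomputable section

namespace Literature.Computability.AlgebraicComplexity

open _root_.Computability Literature.Computability.Complexity Brick HashBricks Plumb OracleCompose Polynomial
open Literature.Computability.Complexity.SharpSATVerif (encode_literal encode_clause encode_cnf)
open Valiant3CNF

namespace ValiantFP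

variable (ψ : CNF ℕ)

/-! ### Codes of the formula, read by index -/

/-- `encList = body` (the nested-pair fold of `StackLists.lean` and of `OracleComposition.lean` agree). [folklore] -/
theorem encList_eq_body' : ∀ l : List (List Bool), encList l = body l
  | [] => rfl
  | a :: l => by rw [encList_cons, body_cons, encList_eq_body' l]

/-- The canonical code of a CNF: `⟨1ᵐ, body (clause codes)⟩`. [cite: AroraBarak2009, §0.1] -/
theorem encode_eq : encodingCNF.encode ψ = boolPair (ones ψ.length) (body (ψ.map encodingClause.encode)) := by
  rw [encode_cnf, OracleCompose.unaryEncodeNat_eq_replicate, encList_eq_body']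

/-- The code of a clause: `⟨1^{|c|}, body (literal codes)⟩`. [cite: AroraBarak2009, §0.1] -/
theorem encode_clause_eq (c : Clause ℕ) :
    encodingClause.encode c = boolPair (ones c.length) (body (c.map encodingLiteral.encode)) := by
  rw [encode_clause, OracleCompose.unaryEncodeNat_eq_replicate, encList_eq_body']

/-- Clause index `o / 3` and position `o mod 3` of occurrence `o`, on `1ᵒ`. [folklore] -/
def qr3F : List Bool → List Bool := divModFn ∘ fanoutFn (fun _ => ones 3) id

/-- `qr3F 1ᵒ = ⟨1^{o/3}, 1^{o mod 3}⟩`. [folklore] -/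
@[simp] theorem qr3F_ones (o : ℕ) : qr3F (ones o) = boolPair (ones (o / 3)) (ones (o % 3)) := by
  simp [qr3F]

/-- `qr3F ∈ FP`. [folklore] -/
theorem qr3F_mem_FP : qr3F ∈ FP := comp_mem_FP divModFn_mem_FP (fanoutFn_mem_FP (const_mem_FP _) id_mem_FP)

/-- **The code of the literal of occurrence `o`**, on `⟨⌜ψ⌝, 1ᵒ⟩`: item `o mod 3` of item `o / 3` of
the clause list. [cite: AroraBarak2009, §1.3 (loops)] -/
def litF : List Bool → List Bool :=
  nthItemFn ∘ fanoutFn (sndF ∘ qr3F ∘ sndF) (sndF ∘ nthItemFn ∘ fanoutFn (fstF ∘ qr3F ∘ sndF) (sndF ∘ fstF))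

/-- `litF ∈ FP`. [folklore] -/
theorem litF_mem_FP : litF ∈ FP :=
  comp_mem_FP nthItemFn_mem_FP (fanoutFn_mem_FP (comp_mem_FP sndF_mem_FP (comp_mem_FP qr3F_mem_FP sndF_mem_FP))
    (comp_mem_FP sndF_mem_FP (comp_mem_FP nthItemFn_mem_FP
      (fanoutFn_mem_FP (comp_mem_FP fstF_mem_FP (comp_mem_FP qr3F_mem_FP sndF_mem_FP)) (comp_mem_FP sndF_mem_FP fstF_mem_FP)))))

/-- **Value of `litF`** on the code of a 3-CNF: the code `⟨bin v, [b]⟩` of the literal `lit3 ψ o`. [cite: AroraBarak2009, §1.3 (loops)] -/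
theorem litF_encode (hw : CNF.IsWidthEq 3 ψ) (o : Fin (3 * ψ.length)) :
    litF (boolPair (encodingCNF.encode ψ) (ones o.val)) =
      boolPair (encodeNat (lit3 ψ hw o).1) [(lit3 ψ hw o).2] := by
  have ho := o.isLt
  have hj : o.val / 3 < ψ.length := by omega
  have hi : o.val % 3 < (ψ[o.val / 3]).length := by
    rw [hw _ (List.getElem_mem _)]; exact Nat.mod_lt _ (by norm_num)
  simp only [litF, Function.comp_apply, fanoutFn_apply, sndF_boolPair, fstF_boolPair, qr3F_ones, encode_eq,
    nthItemFn_body, List.getD_eq_getElem?_getD, List.getElem?_map, List.getElem?_eq_getElem hj,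
    Option.map_some, Option.getD_some, encode_clause_eq, List.getElem?_eq_getElem hi, encode_literal]
  rfl

/-- The variable numeral of the literal of occurrence `o`. [folklore] -/
def varF : List Bool → List Bool := fstF ∘ litF

/-- The polarity bit of the literal of occurrence `o`. [folklore] -/
def polF : List Bool → List Bool := headBitFn ∘ sndF ∘ litF

/-- `varF ∈ FP`. [folklore] -/
theorem varF_mem_FP : varF ∈ FP := comp_mem_FP fstF_mem_FP litF_mem_FP

/-- `polF ∈ FP`. [folklore] -/
theorem polF_mem_FP : polF ∈ FP := comp_mem_FP headBitFn_mem_FP (comp_mem_FP sndF_mem_FP litF_mem_FP)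

/-- `polF` is one-bit. [folklore] -/
theorem oneBit_polF : OneBit polF := oneBit_headBitFn.comp _

/-- Value of `varF`. [folklore] -/
theorem varF_encode (hw : CNF.IsWidthEq 3 ψ) (o : Fin (3 * ψ.length)) :
    varF (boolPair (encodingCNF.encode ψ) (ones o.val)) = encodeNat (lit3 ψ hw o).1 := by
  rw [varF, Function.comp_apply, litF_encode ψ hw, fstF_boolPair]

/-- Value of `polF`. [folklore] -/
theorem polF_encode (hw : CNF.IsWidthEq 3 ψ) (o : Fin (3 * ψ.length)) :
    polF (boolPair (encodingCNF.encode ψ) (ones o.val)) = [(lit3 ψ hw o).2] := by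
  rw [polF, Function.comp_apply, Function.comp_apply, litF_encode ψ hw, sndF_boolPair, headBitFn_apply]
  rfl

/-! ### Equality of variables of two occurrences -/

/-- **`varEqF ⟨⌜ψ⌝, ⟨1ᵒ, 1ᵒ'⟩⟩ = [var o = var o']`**: the two variable numerals compared by `eqPairFn`. [folklore] -/
def varEqF : List Bool → List Bool :=
  eqPairFn ∘ fanoutFn (varF ∘ fanoutFn fstF (fstF ∘ sndF)) (varF ∘ fanoutFn fstF (sndF ∘ sndF))

/-- `varEqF ∈ FP`. [folklore] -/
theorem varEqF_mem_FP : varEqF ∈ FP :=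
  comp_mem_FP eqPairFn_mem_FP (fanoutFn_mem_FP (comp_mem_FP varF_mem_FP (fanoutFn_mem_FP fstF_mem_FP (comp_mem_FP fstF_mem_FP sndF_mem_FP)))
    (comp_mem_FP varF_mem_FP (fanoutFn_mem_FP fstF_mem_FP (comp_mem_FP sndF_mem_FP sndF_mem_FP))))

/-- `varEqF` is one-bit. [folklore] -/
theorem oneBit_varEqF : OneBit varEqF := oneBit_eqPairFn.comp _

/-- **Value of `varEqF`** on two occurrences of a 3-CNF. [folklore] -/
theorem varEqF_encode (hw : CNF.IsWidthEq 3 ψ) (o o' : Fin (3 * ψ.length)) :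
    varEqF (boolPair (encodingCNF.encode ψ) (boolPair (ones o.val) (ones o'.val))) =
      [decide (var? ψ o.val = var? ψ o'.val)] := by
  simp only [varEqF, Function.comp_apply, fanoutFn_apply, fstF_boolPair, sndF_boolPair, varF_encode ψ hw,
    eqPairFn_boolPair, var?_eq_var?_iff ψ hw]
  congr 1
  rw [Bool.decide_congr encodeNat_inj]

/-! ### The occurrence predicates -/

/-- `o` is the first occurrence of its variable: `∀ i < o, var i ≠ var o`, on `⟨⌜ψ⌝, 1ᵒ⟩` (index-all
loop over `i < o`, yardstick `1ᵒ`). [cite: AroraBarak2009, §1.3 (bounded loops)] -/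
def isFirstF : List Bool → List Bool :=
  allIdxFn sndF (notFn (varEqF ∘ fanoutFn (fstF ∘ fstF) (fanoutFn sndF (sndF ∘ fstF))))

/-- `isFirstF ∈ FP`. [folklore] -/
theorem isFirstF_mem_FP : isFirstF ∈ FP :=
  allIdxFn_mem_FP sndF_mem_FP
    (notFn_mem_FP (comp_mem_FP varEqF_mem_FP (fanoutFn_mem_FP (comp_mem_FP fstF_mem_FP fstF_mem_FP)
      (fanoutFn_mem_FP sndF_mem_FP (comp_mem_FP sndF_mem_FP fstF_mem_FP)))))
    (oneBit_notFn (oneBit_varEqF.comp _))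

/-- `isFirstF` is one-bit. [folklore] -/
theorem oneBit_isFirstF : OneBit isFirstF :=
  oneBit_allIdxFn (oneBit_notFn (oneBit_varEqF.comp _)) fun u => by
    have := length_fstF_sndF_le u; omega

/-- **Value of `isFirstF`**: `[isFirst3 ψ o]`. [cite: Valiant1979, Lemma 3.1] -/
theorem isFirstF_encode (hw : CNF.IsWidthEq 3 ψ) (o : Fin (3 * ψ.length)) :
    isFirstF (boolPair (encodingCNF.encode ψ) (ones o.val)) = [decide (isFirst3 ψ o.val)] := by
  rw [isFirstF, allIdxFn_apply (oneBit_notFn (oneBit_varEqF.comp _))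
    (by rw [sndF_boolPair, length_boolPair]; simp)]
  have key : (∀ i < (sndF (boolPair (encodingCNF.encode ψ) (ones o.val))).length,
      (notFn (varEqF ∘ fanoutFn (fstF ∘ fstF) (fanoutFn sndF (sndF ∘ fstF))))
        (boolPair (boolPair (encodingCNF.encode ψ) (ones o.val)) (ones i)) = [true]) ↔ isFirst3 ψ o.val := by
    rw [sndF_boolPair, List.length_replicate]
    unfold isFirst3
    refine forall₂_congr fun i hi => ?_
    have hi3 : i < 3 * ψ.length := lt_trans hi o.isLt
    rw [notFn_apply (b := decide (var? ψ i = var? ψ o.val)) (by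
      simp only [Function.comp_apply, fanoutFn_apply, fstF_boolPair, sndF_boolPair]
      exact varEqF_encode ψ hw ⟨i, hi3⟩ o)]
    simp
  simp only [key]

/-- `o` is the last occurrence of its variable among `o' < 3m`: `∀ i < 3m, o < i → var i ≠ var o`,
on `⟨⌜ψ⌝, 1ᵒ⟩` (index-all loop over `i < 3m`, yardstick `1^{3m}` read off the clause count). [cite: AroraBarak2009, §1.3 (bounded loops)] -/
def isLastF : List Bool → List Bool :=
  allIdxFn (polyFn (3 * X) ∘ fstF ∘ fstF)
    (notFn (andFn (ltLenF ∘ fanoutFn (sndF ∘ fstF) sndF)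
      (varEqF ∘ fanoutFn (fstF ∘ fstF) (fanoutFn sndF (sndF ∘ fstF)))))

/-- The condition of `isLastF` is one-bit. [folklore] -/
theorem oneBit_isLastCond : OneBit (notFn (andFn (ltLenF ∘ fanoutFn (sndF ∘ fstF) sndF)
      (varEqF ∘ fanoutFn (fstF ∘ fstF) (fanoutFn sndF (sndF ∘ fstF))))) :=
  oneBit_notFn (oneBit_andFn (oneBit_ltLenF.comp _) (oneBit_varEqF.comp _))

/-- `isLastF ∈ FP`. [folklore] -/
theorem isLastF_mem_FP : isLastF ∈ FP :=
  allIdxFn_mem_FP (comp_mem_FP (polyFn_mem_FP _) (comp_mem_FP fstF_mem_FP fstF_mem_FP))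
    (notFn_mem_FP (andFn_mem_FP (comp_mem_FP ltLenF_mem_FP (fanoutFn_mem_FP (comp_mem_FP sndF_mem_FP fstF_mem_FP) sndF_mem_FP))
      (comp_mem_FP varEqF_mem_FP (fanoutFn_mem_FP (comp_mem_FP fstF_mem_FP fstF_mem_FP)
        (fanoutFn_mem_FP sndF_mem_FP (comp_mem_FP sndF_mem_FP fstF_mem_FP))))))
    oneBit_isLastCond

/-- The yardstick of `isLastF` always fits: `3 |fstF (fstF u)| ≤ |u|`. [folklore] -/
theorem yard3_le (u : List Bool) : ((polyFn (3 * X) ∘ fstF ∘ fstF) u).length ≤ u.length := by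
  have h1 := length_fstF_sndF_le u
  have h2 := length_fstF_sndF_le (fstF u)
  simp only [Function.comp_apply, polyFn_apply, List.length_replicate, eval_mul, eval_ofNat, eval_X]
  omega

/-- `isLastF` is one-bit. [folklore] -/
theorem oneBit_isLastF : OneBit isLastF := oneBit_allIdxFn oneBit_isLastCond yard3_le

/-- **Value of `isLastF`**: `[isLast3 ψ (3m) o]`. [cite: Valiant1979, Lemma 3.1] -/
theorem isLastF_encode (hw : CNF.IsWidthEq 3 ψ) (o : Fin (3 * ψ.length)) :
    isLastF (boolPair (encodingCNF.encode ψ) (ones o.val)) = [decide (isLast3 ψ (3 * ψ.length) o.val)] := by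
  rw [isLastF, allIdxFn_apply oneBit_isLastCond (yard3_le _)]
  have hyard : ((polyFn (3 * X) ∘ fstF ∘ fstF) (boolPair (encodingCNF.encode ψ) (ones o.val))).length = 3 * ψ.length := by
    simp [encode_eq]
  have key : (∀ i < ((polyFn (3 * X) ∘ fstF ∘ fstF) (boolPair (encodingCNF.encode ψ) (ones o.val))).length,
      (notFn (andFn (ltLenF ∘ fanoutFn (sndF ∘ fstF) sndF)
        (varEqF ∘ fanoutFn (fstF ∘ fstF) (fanoutFn sndF (sndF ∘ fstF)))))
        (boolPair (boolPair (encodingCNF.encode ψ) (ones o.val)) (ones i)) = [true]) ↔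
      isLast3 ψ (3 * ψ.length) o.val := by
    rw [hyard]
    unfold isLast3
    refine forall₂_congr fun i hi => ?_
    rw [notFn_apply (b := decide (o.val < i) && decide (var? ψ i = var? ψ o.val)) (andFn_apply
      (by simp [Function.comp_apply, fanoutFn_apply])
      (by
        simp only [Function.comp_apply, fanoutFn_apply, fstF_boolPair, sndF_boolPair]
        exact varEqF_encode ψ hw ⟨i, hi⟩ o))]
    simp [imp_iff_not_or]
  simp only [key]

/-- `o'` is the next occurrence of the variable of `o`: `var o' = var o ∧ o < o' ∧ ∀ i < o', o < i → var i ≠ var o`,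
on `⟨⌜ψ⌝, ⟨1ᵒ, 1ᵒ'⟩⟩`. [cite: AroraBarak2009, §1.3 (bounded loops)] -/
def isNextF : List Bool → List Bool :=
  andFn (varEqF ∘ fanoutFn fstF (fanoutFn (sndF ∘ sndF) (fstF ∘ sndF)))
    (andFn (ltLenF ∘ sndF)
      (allIdxFn (sndF ∘ sndF)
        (notFn (andFn (ltLenF ∘ fanoutFn (fstF ∘ sndF ∘ fstF) sndF)
          (varEqF ∘ fanoutFn (fstF ∘ fstF) (fanoutFn sndF (fstF ∘ sndF ∘ fstF)))))))

/-- The loop condition of `isNextF` is one-bit. [folklore] -/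
theorem oneBit_isNextCond : OneBit (notFn (andFn (ltLenF ∘ fanoutFn (fstF ∘ sndF ∘ fstF) sndF)
      (varEqF ∘ fanoutFn (fstF ∘ fstF) (fanoutFn sndF (fstF ∘ sndF ∘ fstF))))) :=
  oneBit_notFn (oneBit_andFn (oneBit_ltLenF.comp _) (oneBit_varEqF.comp _))

/-- `isNextF ∈ FP`. [folklore] -/
theorem isNextF_mem_FP : isNextF ∈ FP :=
  andFn_mem_FP (comp_mem_FP varEqF_mem_FP (fanoutFn_mem_FP fstF_mem_FP (fanoutFn_mem_FP (comp_mem_FP sndF_mem_FP sndF_mem_FP)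
      (comp_mem_FP fstF_mem_FP sndF_mem_FP))))
    (andFn_mem_FP (comp_mem_FP ltLenF_mem_FP sndF_mem_FP)
      (allIdxFn_mem_FP (comp_mem_FP sndF_mem_FP sndF_mem_FP)
        (notFn_mem_FP (andFn_mem_FP
          (comp_mem_FP ltLenF_mem_FP (fanoutFn_mem_FP (comp_mem_FP fstF_mem_FP (comp_mem_FP sndF_mem_FP fstF_mem_FP)) sndF_mem_FP))
          (comp_mem_FP varEqF_mem_FP (fanoutFn_mem_FP (comp_mem_FP fstF_mem_FP fstF_mem_FP)
            (fanoutFn_mem_FP sndF_mem_FP (comp_mem_FP fstF_mem_FP (comp_mem_FP sndF_mem_FP fstF_mem_FP)))))))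
        oneBit_isNextCond))

/-- The yardstick of `isNextF` always fits. [folklore] -/
theorem yardNext_le (u : List Bool) : ((sndF ∘ sndF) u).length ≤ u.length := by
  have h1 := length_fstF_sndF_le u
  have h2 := length_fstF_sndF_le (sndF u)
  simp only [Function.comp_apply]
  omega

/-- `isNextF` is one-bit. [folklore] -/
theorem oneBit_isNextF : OneBit isNextF :=
  oneBit_andFn (oneBit_varEqF.comp _) (oneBit_andFn (oneBit_ltLenF.comp _) (oneBit_allIdxFn oneBit_isNextCond yardNext_le))

/-- **Value of `isNextF`**: `[isNext3 ψ o o']`. [cite: Valiant1979, Lemma 3.1] -/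
theorem isNextF_encode (hw : CNF.IsWidthEq 3 ψ) (o o' : Fin (3 * ψ.length)) :
    isNextF (boolPair (encodingCNF.encode ψ) (boolPair (ones o.val) (ones o'.val))) =
      [decide (isNext3 ψ o.val o'.val)] := by
  have h1 : (varEqF ∘ fanoutFn fstF (fanoutFn (sndF ∘ sndF) (fstF ∘ sndF)))
      (boolPair (encodingCNF.encode ψ) (boolPair (ones o.val) (ones o'.val))) = [decide (var? ψ o'.val = var? ψ o.val)] := by
    simp only [Function.comp_apply, fanoutFn_apply, fstF_boolPair, sndF_boolPair]
    exact varEqF_encode ψ hw o' o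
  have h2 : (ltLenF ∘ sndF) (boolPair (encodingCNF.encode ψ) (boolPair (ones o.val) (ones o'.val))) = [decide (o.val < o'.val)] := by
    simp
  have h3 : allIdxFn (sndF ∘ sndF) (notFn (andFn (ltLenF ∘ fanoutFn (fstF ∘ sndF ∘ fstF) sndF)
      (varEqF ∘ fanoutFn (fstF ∘ fstF) (fanoutFn sndF (fstF ∘ sndF ∘ fstF)))))
      (boolPair (encodingCNF.encode ψ) (boolPair (ones o.val) (ones o'.val))) =
      [decide (∀ i < o'.val, o.val < i → var? ψ i ≠ var? ψ o.val)] := by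
    rw [allIdxFn_apply oneBit_isNextCond (yardNext_le _)]
    have hyard : ((sndF ∘ sndF) (boolPair (encodingCNF.encode ψ) (boolPair (ones o.val) (ones o'.val)))).length = o'.val := by
      simp
    have key : (∀ i < ((sndF ∘ sndF) (boolPair (encodingCNF.encode ψ) (boolPair (ones o.val) (ones o'.val)))).length,
        (notFn (andFn (ltLenF ∘ fanoutFn (fstF ∘ sndF ∘ fstF) sndF)
          (varEqF ∘ fanoutFn (fstF ∘ fstF) (fanoutFn sndF (fstF ∘ sndF ∘ fstF)))))
          (boolPair (boolPair (encodingCNF.encode ψ) (boolPair (ones o.val) (ones o'.val))) (ones i)) = [true]) ↔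
        ∀ i < o'.val, o.val < i → var? ψ i ≠ var? ψ o.val := by
      rw [hyard]
      refine forall₂_congr fun i hi => ?_
      have hi3 : i < 3 * ψ.length := lt_trans hi o'.isLt
      rw [notFn_apply (b := decide (o.val < i) && decide (var? ψ i = var? ψ o.val)) (andFn_apply
        (by simp [Function.comp_apply, fanoutFn_apply])
        (by
          simp only [Function.comp_apply, fanoutFn_apply, fstF_boolPair, sndF_boolPair]
          exact varEqF_encode ψ hw ⟨i, hi3⟩ o))]
      simp [imp_iff_not_or]
    simp only [key]
  rw [isNextF, andFn_apply h1 (andFn_apply h2 h3)]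
  simp only [isNext3, Bool.decide_and, ne_eq]

end ValiantFP

end Literature.Computability.AlgebraicComplexity
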